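import Summits.QuantumFields.YangMills.Theorems.BalabanUVNodesN14FibreOscillationOfDecoupling
import Summits.QuantumFields.BalabanUV.T4Continuum.Spine.NE1p.TiltedMeanInfluenceModel
import Mathlib.Analysis.PSeries

/-!
# DAG node N14 (NE1′) — THE WINDOW KEY'S PRICE ON THE N14 SIDE IS THE TAIL OF NE1′'s ONE-RUN OLD-INFLUENCE BUDGET BEYOND THE WINDOW: second order closes it ONLY IF
# THE WINDOW GROWS (`j⋆(K) ≥ c·log K`, `c·log a⁻¹ > 1`; `c > 1∕(2 log L)` at `a = θ₁²Λ = L⁻²`); a bounded window does not; first order gives no budget at all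

Cell `pub-ymgap` (HUMAN RULING D-0062, Track A; D-0149 width push), WIDTH SEAT `pub-ymgap-dag-n14-w2` (NODE n14 = NE1′), generation 7, FILE 11; `--kind proof --supports
stmt-QuantumFields-27366 --as helper` (K3⁸ `SpineGivenEndpointR13SepCoPHV`, KEY MAP v2; helper, NOT a discharge; count-neutral).  THEOREMS ONLY (0 `def`, 0 `instance`,
0 `notation`, 0 `sorry`).  ADDITIVE — imports this seat's g6 FILE 8 `…N14FibreOscillationOfDecoupling` (p622595; through it FILE 7 p620796 `tiltedMeanMatching_push_of_fibreOsc`,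
NE1′'s `Spine/NE1p/TiltedMeanInfluence` ∕ `TiltedMeanCrossover` and seat ne7's `Spine/NE7/QLa` ∕ `QLaBudget`), NE1′'s `Spine/NE1p/TiltedMeanInfluenceModel` (`tiltedMean_pi_sum`)
and `Mathlib.Analysis.PSeries` ONLY — everything CITED BY NAME, nothing re-typed; modifies nothing.

WHY.  K3 «v6» (plan g83∕g84; crux card `window-key-core`, `Cruxes/SpineGivenEndpointR13SepCoPH/Ideas/window-key-core.md`) re-keys the core law of stub 2 at Bałaban's
PENDING WINDOW `j⋆(K)` instead of the full (2.18)-history key.  dag-n20-w3's module 12 `…N20WindowKeyBudget` (p606497) priced the N19′ side: the window budget of the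
core RADIUS is summable iff the window is a SMALL FRACTION of `K` (any `o(K)` window, in particular the card's `j⋆(K) = L·R_w + c₀ + κ₁·log K`, is fine; the full key is
not).  On the N14 side this seat's g6 FILE 7 priced the DESCENT of N14's binder to a coarser key by the ONE-RUN FIBRE OSCILLATION `ω_K` of run A's fine class-wise
tilted means over a coarse class (`tiltedMeanMatching_push_of_fibreOsc`; FILE 8: ONE decoupled old slot).  Over a WINDOW fibre the fine classes differ in ALL slots older than
the window (`vol·Λ^{age}` per age), so the letter is booked against NE1′'s own SCALE LEDGER (`TiltedMeanCrossover.OldInfluenceBudget` = ne7's `Spine.NE7.QLa`, ratio `a`).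
THIS FILE does that booking:
* §1 [pure sums] ★ `sum_old_abs_le_of_qla` — the part of a one-run `QLa` slice budget (reference `0`, ratio `0 ≤ a < 1`) carried by the slots of age `≥ m` is
  `≤ vol·E·a^m∕(1−a)`: the TAIL beyond the window.
* §2 [shape ⇒ letter] ★★ `fibreOsc_le_tail_of_windowLedger` — the WINDOW LEDGER (hypothesis shape, displayed, NOT PRINTED: across a good window fibre the two fine
  classes' tilted means differ by their OLD-slot influences only — base term and young slots are common — and each class carries the one-run `QLa`) gives FILE 7's
  letter `hω` VERBATIM with `ω_K = 2·vol·E·a^{j⋆(K)}∕(1−a)`.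
* §3 [composition BY NAME] ★★★ `tiltedMeanMatching_window_of_fineBinder_of_windowLedger` — FILE 7's `tiltedMeanMatching_push_of_fibreOsc` fed by §2: N14's binder AT THE
  WINDOW KEY ⇐ the fine binder `η` + the window ledger, rate `η_K + 2volE·a^{j⋆(K)}∕(1−a)`; no two-run conditional-law input.
* §4 [the schedule] ★ `summable_pow_window_of_log_schedule` — `Σ_K a^{j⋆(K)} < ∞` as soon as `j⋆(K) ≥ c·log K` (`K ≥ 1`) with `c·log a⁻¹ > 1` (comparison with the
  `p`-series `K^{c·log a}`); ★ `summable_secondOrder_window` — in `d = 4` with `θ₁ = L⁻³`, `Λ = L⁴` the second-order ratio is `a = θ₁²Λ = L⁻²` (ne7 `rate_secondOrder_eq`),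
  so the rider reads `c > 1∕(2·log L)`; ★ `not_summable_tail_of_bounded_window` — a window bounded along a subsequence leaves the tail majorant `↛ 0`, NOT summable (the
  N14 twin, pointing the OTHER way, of module 12's `not_summable_windowBudget_fullKey`): on the N14 side the window must GROW.
* §5 [the decoupled window caricature — the shape inhabited by the mechanism] fine classes `τ` carry PRODUCT slot laws `⊗_X κ K τ X` on `D → S`, the loop reads
  `Σ_X h K X (x X)` with `|h K X| ≤ amp K X ≤ c₁·θ₁^{K − sc K X}` and `≤ vol·Λ^{K−j}` slots of scale `j`; classes of ONE window fibre have the SAME young slot laws.  Then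
  `tiltedMean_pi_sub_eq_sum_old` (the ledger shape BY CONSTRUCTION, `tiltedMean_pi_sum`), `qla_pi_of_centred` (CENTRED slots ⇒ the one-run `QLa` with `E = l₀c₁²`,
  `a = θ₁²Λ` — NE1′'s `abs_tiltedMean_le_of_centred` + `sum_sq_amp_le`: SECOND ORDER), ★★ `fibreOsc_window_pi` (FILE 7's ω-letter INHABITED:
  `ω_K = 2·vol·l₀c₁²·(θ₁²Λ)^{j⋆(K)}∕(1−θ₁²Λ)`), and `qla_pi_firstOrder` ∕ `no_tail_at_firstOrder` (UNCENTRED slots give the ratio `θ₁Λ = L > 1`: NO tail budget).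
* §6 [sharpness, A6] the TWO-CLASS DIRAC LEDGER: one slot per scale with second-order influence `±E·b^{K−j}`, the two fine classes of one window class realised as
  Dirac masses at `±S_K`, `S_K` = the old tail (`tiltedMean_dirac`, `dirac_ledger_osc_eq`, `dirac_ledger_qla`: §2's shape holds, `vol = 1`); the oscillation EQUALS
  `2·S_K ≥ 2E·b^{j⋆(K)}` (`le_dirac_ledger_tail`), so ★ `not_summable_osc_of_dirac_ledger_of_bounded_window`: with a window bounded along a subsequence NO letter `ω`
  for this ledger is summable — §4's converse bites on the LETTER, not only on the majorant.
LOCATED (count-neutral, for the `kr := wkey` design): the admissible windows for the PAIR (N19′ radius — module 12; N14 descent — here) are «`c·log K ≤ j⋆(K) = o(K)`»,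
non-empty; the card's `j⋆(K) = L·R_w + c₀ + κ₁·log K` sits inside iff `κ₁ > 1∕(2 ln L)` in the caricature's numbers — a rider next to its own `κ₁ := 2∕(c − 4 log L)`.

HONEST FRAMING.  [folklore] finite-sum ∕ geometric-series ∕ `p`-series bookkeeping and product-measure Fubini BY NAME on hypothesis SHAPES and a CARICATURE (product slot laws
are NOT Bałaban's class-conditioned laws — there decoupling is the cluster expansion of [B13] §§1–2 and the slot census is NODE O's object; the scale ledger, the amplitudes
`θ₁^{age}`, the counts `Λ^{age}` and the centring are the NE1′ record's UNPRINTED letters, produced by nobody for his runs; `wkey` is not declared at Stage 13); proves NO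
estimate of the programme; nothing of Bałaban's asserted or instantiated; NE1′ ∕ NE7 ∕ NE7b NOT PRINTED as two-run statements for `d = 4`, NOT proved; N14 ∕ N19 ∕ N20 NOT
discharged; K3⁸ OPEN (v6 `b4e55110ab73e679` untouched), K3⁷ aside; counts UNMOVED.  One finite 𝕋⁴ programme at fixed `ε`; R4 closes only the CONDITIONAL finite-𝕋⁴ rung
`BalabanLadder.UV` — NOT ℝ⁴, NOT OS, NOT the Yang–Mills mass gap (Clay), which is NOT proved by any of this.
-/

noncomputable section

open MeasureTheory ProbabilityTheory Finset Filter

namespace YMDAG.N14.WindowOscillationLedger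

open Summit.QuantumFields.BalabanUV.T4Continuum.NE1p.DressedMGFForm (tiltedMean MGFForm TiltedMeanMatching)
open Summit.QuantumFields.BalabanUV.T4Continuum.NE1p.TiltedMeanInfluence (abs_tiltedMean_le abs_tiltedMean_le_of_centred sum_sq_amp_le)
open Summit.QuantumFields.BalabanUV.T4Continuum.NE1p.TiltedMeanInfluenceModel (tiltedMean_pi_sum)
open Summit.QuantumFields.BalabanUV.T4Continuum.Spine.NE7 (QLa rate_secondOrder_eq rate_secondOrder_lt_one one_lt_rate_firstOrder)
open YMDAG.N14.BinderKeyCoarsening (tiltedMeanMatching_push_of_fibreOsc)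

/-! ## §1 The tail of a one-run geometric slice budget beyond a window (pure sums) -/

section Tail

variable {D : Type*}

/-- ★ **THE OLD PART OF A ONE-RUN `QLa` LEDGER IS BOUNDED BY THE TAIL BEYOND THE WINDOW.**  A ledger `wf` of slots with scales `sc`, data `ct` obeying seat ne7's one-run
slice shape `Spine.NE7.QLa wf sc ct 0 K vol E a` (the scale-`j` slice of `|ct|` is `≤ vol·E·a^{K−j}` for `j ≤ K` — gen 3's `OldInfluenceBudget` currency), `vol, E ≥ 0`,
`0 ≤ a < 1`.  Then the slots of AGE `≥ m` (`sc X + m ≤ K`: born at least `m` levels below the current one — exactly the slots a window of length `m` forgets) carry at most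
`vol·E·a^m∕(1−a)`. [folklore] -/
theorem sum_old_abs_le_of_qla {wf : Finset D} {sc : D → ℕ} {ct : D → ℝ} {K m : ℕ} {vol E a : ℝ}
    (hq : QLa wf sc ct (fun _ => 0) K vol E a) (hvol : 0 ≤ vol) (hE : 0 ≤ E) (ha0 : 0 ≤ a) (ha1 : a < 1) :
    ∑ X ∈ wf with sc X + m ≤ K, |ct X| ≤ vol * E * a ^ m / (1 - a) := by
  have hRHS : 0 ≤ vol * E * a ^ m / (1 - a) := div_nonneg (by positivity) (sub_pos.mpr ha1).le
  have hq' : ∀ j ≤ K, ∑ X ∈ wf with sc X = j, |ct X| ≤ vol * (E * a ^ (K - j)) := fun j hj => by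
    simpa only [sub_zero] using hq j hj
  by_cases hKm : m ≤ K
  · obtain ⟨N, rfl⟩ := Nat.exists_eq_add_of_le hKm
    -- the geometric block `Σ_{j ≤ N} a^{m+j} ≤ a^m∕(1−a)` (Mathlib `tsum_geometric_of_lt_one`)
    have hgeom : ∑ j ∈ range (N + 1), a ^ (m + j) ≤ a ^ m / (1 - a) := by
      have hs := summable_geometric_of_lt_one ha0 ha1
      calc ∑ j ∈ range (N + 1), a ^ (m + j) = a ^ m * ∑ j ∈ range (N + 1), a ^ j := by
            rw [mul_sum]; exact sum_congr rfl fun j _ => pow_add a m j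
        _ ≤ a ^ m * ∑' j, a ^ j :=
            mul_le_mul_of_nonneg_left (hs.sum_le_tsum _ fun j _ => pow_nonneg ha0 j) (pow_nonneg ha0 m)
        _ = a ^ m / (1 - a) := by rw [tsum_geometric_of_lt_one ha0 ha1, div_eq_mul_inv]
    have hmaps : ∀ X ∈ wf.filter (fun X => sc X + m ≤ m + N), sc X ∈ range (N + 1) := fun X hX => by
      have := (mem_filter.mp hX).2
      exact mem_range.mpr (by omega)
    rw [← sum_fiberwise_of_maps_to hmaps]
    calc ∑ j ∈ range (N + 1), ∑ X ∈ (wf.filter fun X => sc X + m ≤ m + N) with sc X = j, |ct X|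
        ≤ ∑ j ∈ range (N + 1), vol * (E * a ^ (m + N - j)) := sum_le_sum fun j hj => by
          have hjN : j < N + 1 := mem_range.mp hj
          calc ∑ X ∈ (wf.filter fun X => sc X + m ≤ m + N) with sc X = j, |ct X|
              ≤ ∑ X ∈ wf with sc X = j, |ct X| :=
                sum_le_sum_of_subset_of_nonneg (filter_subset_filter _ (filter_subset _ wf)) fun _ _ _ => abs_nonneg _
            _ ≤ vol * (E * a ^ (m + N - j)) := hq' j (by omega)
      _ = vol * E * ∑ j ∈ range (N + 1), a ^ (m + (N + 1 - 1 - j)) := by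
          rw [mul_sum]
          exact sum_congr rfl fun j hj => by
            have hjN : j < N + 1 := mem_range.mp hj
            rw [show m + N - j = m + (N + 1 - 1 - j) by omega]; ring
      _ = vol * E * ∑ j ∈ range (N + 1), a ^ (m + j) := by rw [sum_range_reflect (fun j => a ^ (m + j)) (N + 1)]
      _ ≤ vol * E * (a ^ m / (1 - a)) := mul_le_mul_of_nonneg_left hgeom (by positivity)
      _ = vol * E * a ^ m / (1 - a) := by ring
  · have hempty : wf.filter (fun X => sc X + m ≤ K) = ∅ := filter_eq_empty_iff.mpr fun X _ h => hKm (by omega)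
    rw [hempty, sum_empty]
    exact hRHS

/-- Two numbers that differ by the OLD parts of two `QLa` ledgers only are `2·vol·E·a^m∕(1−a)`-close. [folklore] -/
theorem abs_sub_le_two_tail {wfA wfB : Finset D} {sc : D → ℕ} {cA cB : D → ℝ} {x y : ℝ} {K m : ℕ} {vol E a : ℝ}
    (hdiff : x - y = ∑ X ∈ wfA with sc X + m ≤ K, cA X - ∑ X ∈ wfB with sc X + m ≤ K, cB X)
    (hqA : QLa wfA sc cA (fun _ => 0) K vol E a) (hqB : QLa wfB sc cB (fun _ => 0) K vol E a)
    (hvol : 0 ≤ vol) (hE : 0 ≤ E) (ha0 : 0 ≤ a) (ha1 : a < 1) :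
    |x - y| ≤ 2 * (vol * E * a ^ m / (1 - a)) := by
  rw [hdiff]
  have h1 := (abs_sum_le_sum_abs _ _).trans (sum_old_abs_le_of_qla (m := m) hqA hvol hE ha0 ha1)
  have h2 := (abs_sum_le_sum_abs _ _).trans (sum_old_abs_le_of_qla (m := m) hqB hvol hE ha0 ha1)
  exact (abs_sub _ _).trans (by linarith)

end Tail

/-! ## §2 The window ledger (one run) gives FILE 7's fibre-oscillation letter with `ω_K = 2·vol·E·a^{j⋆(K)}∕(1−a)` -/

section Ledger

variable {ι κ D : Type*} [DecidableEq κ] {Ω : ℕ → Type*} [∀ K, MeasurableSpace (Ω K)]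
  {l₀ vol E a : ℝ} {T : ℕ → Finset ι} {f : ℕ → ι → κ} {Bad' : ℕ → ℝ → Finset κ}
  {F : ∀ K, Ω K → ℝ} {ν : ∀ K, ι → Measure (Ω K)}
  {wf : ℕ → ι → Finset D} {sc : ℕ → D → ℕ} {Δ : ℕ → ℝ → ι → ℝ → D → ℝ} {win : ℕ → ℕ}

/-- ★★ **THE WINDOW LEDGER GIVES FILE 7's LETTER `hω` WITH THE TAIL OF THE ONE-RUN OLD BUDGET.**  Run A's fine class pieces `ν K τ`, a key coarsening `f K` (the window key,
window length `win K`), a coarse bad policy `Bad′`.  WINDOW LEDGER (hypothesis shape, displayed — NOT PRINTED; NODE O's object for Bałaban's runs): (i) for two fine classes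
`τ, τ′` of one GOOD coarse class, at every source `|t| ≤ l₀` and tilt `|s| ≤ l₀`, the class-wise tilted means of the loop differ by the influences of the OLD slots ONLY
(`sc K X + win K ≤ K`; base term and young slots are common to the fibre), and (ii) on every such class the influence data obey seat ne7's one-run slice shape
`QLa (wf K τ) (sc K) (Δ K t τ s) 0 K vol E a` (= gen 3's `OldInfluenceBudget` at that class).  THEN, for `vol, E ≥ 0`, `0 ≤ a < 1`, FILE 7's oscillation letter holds
VERBATIM with `ω K = 2·vol·E·a^{win K}∕(1−a)`. [folklore] -/
theorem fibreOsc_le_tail_of_windowLedger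
    (hwin : ∀ (K : ℕ) (t : ℝ), |t| ≤ l₀ → ∀ k ∈ (T K).image (f K) \ Bad' K t,
      ∀ τ ∈ (T K).filter (fun τ => f K τ = k), ∀ τ' ∈ (T K).filter (fun τ => f K τ = k), ∀ s : ℝ, |s| ≤ l₀ →
        tiltedMean (F K) (ν K τ) s - tiltedMean (F K) (ν K τ') s
          = ∑ X ∈ (wf K τ) with sc K X + win K ≤ K, Δ K t τ s X - ∑ X ∈ (wf K τ') with sc K X + win K ≤ K, Δ K t τ' s X)
    (hqla : ∀ (K : ℕ) (t : ℝ), |t| ≤ l₀ → ∀ k ∈ (T K).image (f K) \ Bad' K t,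
      ∀ τ ∈ (T K).filter (fun τ => f K τ = k), ∀ s : ℝ, |s| ≤ l₀ → QLa (wf K τ) (sc K) (Δ K t τ s) (fun _ => 0) K vol E a)
    (hvol : 0 ≤ vol) (hE : 0 ≤ E) (ha0 : 0 ≤ a) (ha1 : a < 1) :
    ∀ (K : ℕ) (t : ℝ), |t| ≤ l₀ → ∀ k ∈ (T K).image (f K) \ Bad' K t,
      ∀ τ ∈ (T K).filter (fun τ => f K τ = k), ∀ τ' ∈ (T K).filter (fun τ => f K τ = k), ∀ s : ℝ, |s| ≤ l₀ →
        |tiltedMean (F K) (ν K τ) s - tiltedMean (F K) (ν K τ') s| ≤ 2 * (vol * E * a ^ win K / (1 - a)) :=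
  fun K t ht k hk τ hτ τ' hτ' s hs =>
    abs_sub_le_two_tail (hwin K t ht k hk τ hτ τ' hτ' s hs) (hqla K t ht k hk τ hτ s hs) (hqla K t ht k hk τ' hτ' s hs) hvol hE ha0 ha1

/-! ## §3 FILE 7 by name: N14's binder at the window key from the fine binder and the window ledger -/

/-- ★★★ **N14's BINDER AT THE WINDOW KEY ⇐ THE FINE BINDER + THE WINDOW LEDGER** (FILE 7's `tiltedMeanMatching_push_of_fibreOsc` with `hω` supplied by §2).  Both runs' fine
families in MGF form, N14's fine binder `TiltedMeanMatching l₀ T Bad F ν F′ ν′ η`, a coarse bad policy under which the fine classes of a good window class are good, positive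
fibre totals on the tilt window, and run A's WINDOW LEDGER (§2 (i)+(ii)).  Then the pushed (window-keyed) runs satisfy
`TiltedMeanMatching l₀ (K ↦ (T K).image (f K)) Bad′ … (K ↦ η K + 2·vol·E·a^{win K}∕(1−a))` — the descent costs the TAIL of NE1′'s own one-run old budget beyond the
window, and nothing two-run. [folklore] -/
theorem tiltedMeanMatching_window_of_fineBinder_of_windowLedger [DecidableEq ι] {Ω' : ℕ → Type*} [∀ K, MeasurableSpace (Ω' K)] {B : ℝ}
    {Bad : ℕ → ℝ → Finset ι} {F' : ∀ K, Ω' K → ℝ} {ν' : ∀ K, ι → Measure (Ω' K)} {A Bf : ℕ → ℝ → ι → ℝ} {η : ℕ → ℝ}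
    (hA : MGFForm B T F ν A) (hB : MGFForm B T F' ν' Bf) (hη : TiltedMeanMatching l₀ T Bad F ν F' ν' η)
    (hgood : ∀ (K : ℕ) (t : ℝ), |t| ≤ l₀ → ∀ τ ∈ T K, f K τ ∉ Bad' K t → τ ∉ Bad K t)
    (hpos : ∀ (K : ℕ) (t : ℝ), |t| ≤ l₀ → ∀ k ∈ (T K).image (f K) \ Bad' K t, ∀ s : ℝ, |s| ≤ l₀ →
      0 < ∑ τ ∈ (T K).filter (fun τ => f K τ = k), A K s τ ∧ 0 < ∑ τ ∈ (T K).filter (fun τ => f K τ = k), Bf K s τ)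
    (hwin : ∀ (K : ℕ) (t : ℝ), |t| ≤ l₀ → ∀ k ∈ (T K).image (f K) \ Bad' K t,
      ∀ τ ∈ (T K).filter (fun τ => f K τ = k), ∀ τ' ∈ (T K).filter (fun τ => f K τ = k), ∀ s : ℝ, |s| ≤ l₀ →
        tiltedMean (F K) (ν K τ) s - tiltedMean (F K) (ν K τ') s
          = ∑ X ∈ (wf K τ) with sc K X + win K ≤ K, Δ K t τ s X - ∑ X ∈ (wf K τ') with sc K X + win K ≤ K, Δ K t τ' s X)
    (hqla : ∀ (K : ℕ) (t : ℝ), |t| ≤ l₀ → ∀ k ∈ (T K).image (f K) \ Bad' K t,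
      ∀ τ ∈ (T K).filter (fun τ => f K τ = k), ∀ s : ℝ, |s| ≤ l₀ → QLa (wf K τ) (sc K) (Δ K t τ s) (fun _ => 0) K vol E a)
    (hvol : 0 ≤ vol) (hE : 0 ≤ E) (ha0 : 0 ≤ a) (ha1 : a < 1) :
    TiltedMeanMatching l₀ (fun K => (T K).image (f K)) Bad' F (fun K k => ∑ τ ∈ (T K).filter (fun τ => f K τ = k), ν K τ) F'
      (fun K k => ∑ τ ∈ (T K).filter (fun τ => f K τ = k), ν' K τ) (fun K => η K + 2 * (vol * E * a ^ win K / (1 - a))) :=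
  tiltedMeanMatching_push_of_fibreOsc hA hB hη hgood hpos (fibreOsc_le_tail_of_windowLedger hwin hqla hvol hE ha0 ha1)

end Ledger

/-! ## §4 The schedule: logarithmically growing windows make the tail summable; bounded windows do not -/

section Schedule

/-- ★ **LOGARITHMIC WINDOWS SUFFICE.**  `0 < a < 1`, and a window schedule with `j⋆(K) ≥ c·log K` for `K ≥ 1`, where `c·log a⁻¹ > 1`.  Then `Σ_K a^{j⋆(K)} < ∞`
(`a^{j⋆(K)} ≤ K^{−c·log a⁻¹}`, a convergent `p`-series — Mathlib `Real.summable_nat_rpow`). [folklore] -/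
theorem summable_pow_window_of_log_schedule {a c : ℝ} (ha0 : 0 < a) (ha1 : a < 1) {win : ℕ → ℕ}
    (hc : 1 < c * Real.log a⁻¹) (hwin : ∀ K : ℕ, 1 ≤ K → c * Real.log K ≤ win K) :
    Summable (fun K : ℕ => a ^ win K) := by
  have hloga : Real.log a ≤ 0 := Real.log_nonpos ha0.le ha1.le
  have hp : -(c * Real.log a⁻¹) < -1 := by linarith
  have hsum : Summable (fun K : ℕ => (((K + 1 : ℕ) : ℝ)) ^ (-(c * Real.log a⁻¹))) :=
    (summable_nat_add_iff 1).mpr (Real.summable_nat_rpow.mpr hp)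
  refine (summable_nat_add_iff 1).mp (Summable.of_nonneg_of_le (fun K => pow_nonneg ha0.le _) (fun K => ?_) hsum)
  have hKpos : (0 : ℝ) < ((K + 1 : ℕ) : ℝ) := by positivity
  have hw : c * Real.log ((K + 1 : ℕ) : ℝ) ≤ (win (K + 1) : ℝ) := hwin (K + 1) (Nat.succ_le_succ (Nat.zero_le K))
  have hmul : (win (K + 1) : ℝ) * Real.log a ≤ c * Real.log ((K + 1 : ℕ) : ℝ) * Real.log a :=
    mul_le_mul_of_nonpos_right hw hloga
  calc a ^ win (K + 1) = Real.exp (Real.log a * (win (K + 1) : ℝ)) := by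
        rw [← Real.rpow_natCast, Real.rpow_def_of_pos ha0]
    _ ≤ Real.exp (Real.log ((K + 1 : ℕ) : ℝ) * (-(c * Real.log a⁻¹))) := by
        rw [Real.exp_le_exp, Real.log_inv]; nlinarith [hmul]
    _ = (((K + 1 : ℕ) : ℝ)) ^ (-(c * Real.log a⁻¹)) := (Real.rpow_def_of_pos hKpos _).symm

/-- ★ **THE `d = 4` NUMBERS.**  With the loop's per-level sensitivity `θ₁ = L⁻³` and `Λ = L⁴` slots per level the second-order ratio is `θ₁²Λ = L⁻²` (ne7
`rate_secondOrder_eq`), `log a⁻¹ = 2·log L`, and the rider reads `c·(2 log L) > 1`: windows `j⋆(K) ≥ c·log K` with `c > 1∕(2 log L)` make `Σ_K (θ₁²Λ)^{j⋆(K)}` finite.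
[folklore] -/
theorem summable_secondOrder_window {L c : ℝ} (hL : 1 < L) {win : ℕ → ℕ} (hc : 1 < c * (2 * Real.log L))
    (hwin : ∀ K : ℕ, 1 ≤ K → c * Real.log K ≤ win K) :
    Summable (fun K : ℕ => ((L⁻¹ ^ 3) ^ 2 * L ^ 4) ^ win K) := by
  have hL0 : 0 < L := lt_trans one_pos hL
  rw [rate_secondOrder_eq hL0.ne']
  have h0 : 0 < L⁻¹ ^ 2 := by positivity
  have h1 : L⁻¹ ^ 2 < 1 := pow_lt_one₀ (inv_pos.mpr hL0).le (inv_lt_one_of_one_lt₀ hL) two_ne_zero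
  have hlog : Real.log (L⁻¹ ^ 2)⁻¹ = 2 * Real.log L := by
    rw [inv_pow, inv_inv, Real.log_pow]; norm_num
  exact summable_pow_window_of_log_schedule h0 h1 (by rwa [hlog]) hwin

/-- ★ **A BOUNDED WINDOW DOES NOT CLOSE THE N14 SIDE**: if the window is `≤ M` along a subsequence (`∃ᶠ K, j⋆(K) ≤ M` — e.g. a constant window `L·R_w + c₀`), then the
tail majorant `C·a^{j⋆(K)}∕(1−a)` (`C > 0`, `0 < a < 1`) is `≥ C·a^M∕(1−a) > 0` there, does not tend to `0`, and is NOT summable — the N14 twin, pointing the other way, of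
dag-n20-w3's `N20WindowKeyBudget.not_summable_windowBudget_fullKey` (there the window must be a SMALL FRACTION of `K`; here it must GROW). [folklore] -/
theorem not_summable_tail_of_bounded_window {C a : ℝ} (hC : 0 < C) (ha0 : 0 < a) (ha1 : a < 1) {win : ℕ → ℕ} {M : ℕ}
    (hM : ∃ᶠ K : ℕ in atTop, win K ≤ M) : ¬ Summable (fun K : ℕ => C * a ^ win K / (1 - a)) := by
  intro hs
  have h1a : 0 < 1 - a := sub_pos.mpr ha1
  have hε : 0 < C * a ^ M / (1 - a) := by positivity
  have hev : ∀ᶠ K : ℕ in atTop, C * a ^ win K / (1 - a) < C * a ^ M / (1 - a) :=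
    hs.tendsto_atTop_zero.eventually (gt_mem_nhds hε)
  obtain ⟨K, hK, hlt⟩ := (hM.and_eventually hev).exists
  have hge : C * a ^ M / (1 - a) ≤ C * a ^ win K / (1 - a) := by
    have : a ^ M ≤ a ^ win K := pow_le_pow_of_le_one ha0.le ha1.le hK
    gcongr
  exact absurd hlt (not_lt.mpr hge)

end Schedule

/-! ## §5 The decoupled window caricature: the window ledger by construction, second order by centring, and what first order gives -/

section Caricature

variable {ι κ D S : Type*} [DecidableEq κ] [Fintype D] [DecidableEq D] [MeasurableSpace S]
  {μ : ℕ → ι → D → Measure S} [∀ K τ X, IsProbabilityMeasure (μ K τ X)]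
  {h : ℕ → D → S → ℝ} {amp : ℕ → D → ℝ} {sc : ℕ → D → ℕ} {win : ℕ → ℕ} {l₀ vol c₁ θ₁ Λ : ℝ}
  {T : ℕ → Finset ι} {f : ℕ → ι → κ} {Bad' : ℕ → ℝ → Finset κ}

omit [DecidableEq κ] in
/-- **THE WINDOW LEDGER BY CONSTRUCTION.**  In the caricature each fine class `τ` at `K` steps carries the PRODUCT law `⊗_X μ K τ X` of its slot laws on `D → S` and the
loop reads `Σ_X h K X (x X)` (`|h K X| ≤ amp K X`).  If two classes have the SAME slot laws on every YOUNG slot (`¬ (sc K X + win K ≤ K)`), their tilted means differ by the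
OLD slots' own tilted means only — NE1′'s exact decoupling `tiltedMean_pi_sum` and cancellation of the common young terms. [folklore] -/
theorem tiltedMean_pi_sub_eq_sum_old (hhm : ∀ K X, Measurable (h K X)) (hh : ∀ K X y, |h K X y| ≤ amp K X)
    {K : ℕ} {τ τ' : ι} (hyoung : ∀ X, ¬ (sc K X + win K ≤ K) → μ K τ X = μ K τ' X) (s : ℝ) :
    tiltedMean (fun x : D → S => ∑ X, h K X (x X)) (Measure.pi (μ K τ)) s
        - tiltedMean (fun x : D → S => ∑ X, h K X (x X)) (Measure.pi (μ K τ')) s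
      = ∑ X ∈ (univ : Finset D) with sc K X + win K ≤ K, tiltedMean (h K X) (μ K τ X) s
        - ∑ X ∈ (univ : Finset D) with sc K X + win K ≤ K, tiltedMean (h K X) (μ K τ' X) s := by
  rw [tiltedMean_pi_sum (κ := μ K τ) (hhm K) (hh K) s, tiltedMean_pi_sum (κ := μ K τ') (hhm K) (hh K) s,
    ← sum_filter_add_sum_filter_not univ (fun X => sc K X + win K ≤ K) (fun X => tiltedMean (h K X) (μ K τ X) s),
    ← sum_filter_add_sum_filter_not univ (fun X => sc K X + win K ≤ K) (fun X => tiltedMean (h K X) (μ K τ' X) s)]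
  have hy : ∑ X ∈ (univ : Finset D) with ¬ (sc K X + win K ≤ K), tiltedMean (h K X) (μ K τ X) s
      = ∑ X ∈ (univ : Finset D) with ¬ (sc K X + win K ≤ K), tiltedMean (h K X) (μ K τ' X) s :=
    sum_congr rfl fun X hX => by rw [hyoung X (mem_filter.mp hX).2]
  rw [hy]; ring

omit [DecidableEq κ] [DecidableEq D] in
/-- **CENTRED SLOTS ⇒ THE ONE-RUN `QLa` AT SECOND ORDER** (ratio `θ₁²Λ`, size `l₀·c₁²`).  If every slot law centres its contribution (`∫ h K X dμ K τ X = 0` — conjugation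
symmetry in the application), the amplitudes are `0 ≤ amp K X ≤ c₁·θ₁^{K − sc K X}` and at most `vol·Λ^{K−j}` slots have scale `j`, then on `|s| ≤ l₀` the class's influence
data `X ↦ tiltedMean (h K X) (μ K τ X) s` obey `QLa univ (sc K) … 0 K vol (l₀c₁²) (θ₁²Λ)` — NE1′'s `abs_tiltedMean_le_of_centred` (`≤ amp²·|s|`) and `sum_sq_amp_le`. [folklore] -/
theorem qla_pi_of_centred (hhm : ∀ K X, Measurable (h K X)) (hh : ∀ K X y, |h K X y| ≤ amp K X)
    (hcent : ∀ K (τ : ι) X, ∫ y, h K X y ∂μ K τ X = 0) (hamp : ∀ K X, 0 ≤ amp K X ∧ amp K X ≤ c₁ * θ₁ ^ (K - sc K X))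
    (hcount : ∀ K, ∀ j ≤ K, (((univ : Finset D).filter fun X => sc K X = j).card : ℝ) ≤ vol * Λ ^ (K - j))
    (K : ℕ) (τ : ι) {s : ℝ} (hs : |s| ≤ l₀) :
    QLa univ (sc K) (fun X => tiltedMean (h K X) (μ K τ X) s) (fun _ => 0) K vol (l₀ * c₁ ^ 2) (θ₁ ^ 2 * Λ) := by
  intro j hj
  have hsq := sum_sq_amp_le (ι := ι) (wf := fun _ _ => univ) (sc := sc) (fun K _ X _ => hamp K X) (fun K _ => hcount K) K τ j hj
  have hs0 : 0 ≤ |s| := abs_nonneg s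
  calc ∑ X ∈ (univ : Finset D) with sc K X = j, |tiltedMean (h K X) (μ K τ X) s - 0|
      ≤ ∑ X ∈ (univ : Finset D) with sc K X = j, |s| * amp K X ^ 2 := sum_le_sum fun X _ => by
        rw [sub_zero, mul_comm]; exact abs_tiltedMean_le_of_centred (hhm K X) (hh K X) (hcent K τ X) s
    _ = |s| * ∑ X ∈ (univ : Finset D) with sc K X = j, amp K X ^ 2 := by rw [mul_sum]
    _ ≤ l₀ * (vol * (c₁ ^ 2 * (θ₁ ^ 2 * Λ) ^ (K - j))) :=
        mul_le_mul hs hsq (sum_nonneg fun X _ => sq_nonneg _) (hs0.trans hs)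
    _ = vol * (l₀ * c₁ ^ 2 * (θ₁ ^ 2 * Λ) ^ (K - j)) := by ring

/-- ★★ **FILE 7's FIBRE-OSCILLATION LETTER INHABITED AT THE WINDOW KEY BY THE MECHANISM.**  The decoupled window caricature — product slot laws per fine class, centred slot
contributions of amplitude `≤ c₁θ₁^{age}`, `≤ vol·Λ^{age}` slots per age, and the WINDOW property: fine classes of one good window class have the same slot laws on every
young slot — gives, for `vol, l₀ ≥ 0` and `0 ≤ θ₁²Λ < 1`, FILE 7's letter `hω` for run A's pieces `ν K τ := ⊗_X μ K τ X` and the loop `Σ_X h K X` with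
`ω_K = 2·vol·(l₀c₁²)·(θ₁²Λ)^{win K}∕(1 − θ₁²Λ)` — the tail of NE1′'s second-order old budget beyond the window (§2 on §5's ledger). [folklore] -/
theorem fibreOsc_window_pi (hhm : ∀ K X, Measurable (h K X)) (hh : ∀ K X y, |h K X y| ≤ amp K X)
    (hcent : ∀ K (τ : ι) X, ∫ y, h K X y ∂μ K τ X = 0) (hamp : ∀ K X, 0 ≤ amp K X ∧ amp K X ≤ c₁ * θ₁ ^ (K - sc K X))
    (hcount : ∀ K, ∀ j ≤ K, (((univ : Finset D).filter fun X => sc K X = j).card : ℝ) ≤ vol * Λ ^ (K - j))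
    (hyoung : ∀ (K : ℕ) (t : ℝ), |t| ≤ l₀ → ∀ k ∈ (T K).image (f K) \ Bad' K t,
      ∀ τ ∈ (T K).filter (fun τ => f K τ = k), ∀ τ' ∈ (T K).filter (fun τ => f K τ = k), ∀ X, ¬ (sc K X + win K ≤ K) → μ K τ X = μ K τ' X)
    (hvol : 0 ≤ vol) (hl₀ : 0 ≤ l₀) (hb0 : 0 ≤ θ₁ ^ 2 * Λ) (hb1 : θ₁ ^ 2 * Λ < 1) :
    ∀ (K : ℕ) (t : ℝ), |t| ≤ l₀ → ∀ k ∈ (T K).image (f K) \ Bad' K t,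
      ∀ τ ∈ (T K).filter (fun τ => f K τ = k), ∀ τ' ∈ (T K).filter (fun τ => f K τ = k), ∀ s : ℝ, |s| ≤ l₀ →
        |tiltedMean (fun x : D → S => ∑ X, h K X (x X)) (Measure.pi (μ K τ)) s
            - tiltedMean (fun x : D → S => ∑ X, h K X (x X)) (Measure.pi (μ K τ')) s|
          ≤ 2 * (vol * (l₀ * c₁ ^ 2) * (θ₁ ^ 2 * Λ) ^ win K / (1 - θ₁ ^ 2 * Λ)) :=
  fibreOsc_le_tail_of_windowLedger (F := fun K (x : D → S) => ∑ X, h K X (x X)) (ν := fun K τ => Measure.pi (μ K τ))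
    (wf := fun _ _ => univ) (Δ := fun K _ τ s X => tiltedMean (h K X) (μ K τ X) s)
    (fun K t ht k hk τ hτ τ' hτ' s _ => tiltedMean_pi_sub_eq_sum_old hhm hh (hyoung K t ht k hk τ hτ τ' hτ') s)
    (fun K t _ k _ τ _ s hs => qla_pi_of_centred hhm hh hcent hamp hcount K τ hs) hvol (by positivity) hb0 hb1

omit [DecidableEq κ] [DecidableEq D] [∀ K τ X, IsProbabilityMeasure (μ K τ X)] in
/-- **WHAT FIRST ORDER GIVES.**  WITHOUT centring the only per-slot bound is the first-order one `|tiltedMean (h K X) (μ K τ X) s| ≤ amp K X` (NE1′'s `abs_tiltedMean_le`),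
and the same census yields the one-run slice shape with ratio `θ₁·Λ` and size `c₁` — `QLa univ (sc K) … 0 K vol c₁ (θ₁Λ)`, for ANY finite slot laws. [folklore] -/
theorem qla_pi_firstOrder {μ : ℕ → ι → D → Measure S} [∀ K τ X, IsFiniteMeasure (μ K τ X)] (hh : ∀ K X y, |h K X y| ≤ amp K X)
    (hamp : ∀ K X, 0 ≤ amp K X ∧ amp K X ≤ c₁ * θ₁ ^ (K - sc K X))
    (hcount : ∀ K, ∀ j ≤ K, (((univ : Finset D).filter fun X => sc K X = j).card : ℝ) ≤ vol * Λ ^ (K - j))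
    (hc₁ : 0 ≤ c₁) (hθ₁ : 0 ≤ θ₁) (K : ℕ) (τ : ι) (s : ℝ) :
    QLa univ (sc K) (fun X => tiltedMean (h K X) (μ K τ X) s) (fun _ => 0) K vol c₁ (θ₁ * Λ) := by
  intro j hj
  have hc : 0 ≤ c₁ * θ₁ ^ (K - j) := mul_nonneg hc₁ (pow_nonneg hθ₁ _)
  calc ∑ X ∈ (univ : Finset D) with sc K X = j, |tiltedMean (h K X) (μ K τ X) s - 0|
      ≤ ∑ X ∈ (univ : Finset D) with sc K X = j, c₁ * θ₁ ^ (K - j) := sum_le_sum fun X hX => by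
        obtain ⟨h0, h1⟩ := hamp K X
        rw [sub_zero, ← (mem_filter.mp hX).2]
        exact (abs_tiltedMean_le (hh K X) h0 s).trans h1
    _ = (((univ : Finset D).filter fun X => sc K X = j).card : ℝ) * (c₁ * θ₁ ^ (K - j)) := by rw [sum_const, nsmul_eq_mul]
    _ ≤ (vol * Λ ^ (K - j)) * (c₁ * θ₁ ^ (K - j)) := mul_le_mul_of_nonneg_right (hcount K j hj) hc
    _ = vol * (c₁ * (θ₁ * Λ) ^ (K - j)) := by rw [mul_pow]; ring

/-- **… AND IN `d = 4` THAT RATIO IS `θ₁Λ = L > 1`** (ne7 `one_lt_rate_firstOrder`, `θ₁ = L⁻³`, `Λ = L⁴`): §1's tail bound needs `a < 1`, so the first-order ledger yields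
NO window budget whatever the schedule — the descent road of FILE 7 ∕ FILE 10 is fed by the SECOND-ORDER (centred × decoupled) mechanism only (NE1.md R28: «only
second-order bookings close», here for the one-run window oscillation). [folklore] -/
theorem no_tail_at_firstOrder {L : ℝ} (hL : 1 < L) : ¬ (L⁻¹ ^ 3 * L ^ 4 < 1) ∧ (L⁻¹ ^ 3) ^ 2 * L ^ 4 < 1 :=
  ⟨not_lt.mpr (one_lt_rate_firstOrder hL).le, rate_secondOrder_lt_one hL⟩

end Caricature

/-! ## §6 Sharpness: the two-class Dirac ledger — the tail is attained, so a bounded window admits NO summable oscillation letter -/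

section Sharpness

open Summit.QuantumFields.BalabanUV.T4Continuum.NE1p.TiltedMeanInfluence (tiltedMean_eq_div)

/-- Under a Dirac mass the tilted mean is the value at the point (every tilt). [folklore] -/
theorem tiltedMean_dirac (F : ℝ → ℝ) (x s : ℝ) : tiltedMean F (Measure.dirac x) s = F x := by
  rw [tiltedMean_eq_div, integral_dirac, integral_dirac, mul_div_assoc, div_self (Real.exp_pos _).ne', mul_one]

/-- THE TWO-CLASS DIRAC LEDGER (sharpness witness for §2 ∕ §4; A6: the shape of §2 is inhabited with EQUALITY): one slot per scale `j ≤ K` with second-order influence `± E·b^{K−j}`, the two fine classes `true ∕ false`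
of ONE window class realised as Dirac masses at `± S_K`, `S_K := Σ_{j + w K ≤ K} E·b^{K−j}` (the old tail).  The window-ledger shape and the one-run `QLa` (vol = 1) hold,
and the oscillation EQUALS `2·S_K ≥ 2·E·b^{w K}` whenever `w K ≤ K`. -/
theorem dirac_ledger_osc_eq {E b : ℝ} (w : ℕ → ℕ) (K : ℕ) (s : ℝ) :
    tiltedMean (fun x : ℝ => x) (Measure.dirac (∑ j ∈ range (K + 1) with j + w K ≤ K, E * b ^ (K - j))) s
      - tiltedMean (fun x : ℝ => x) (Measure.dirac (-(∑ j ∈ range (K + 1) with j + w K ≤ K, E * b ^ (K - j)))) s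
      = ∑ j ∈ range (K + 1) with j + w K ≤ K, E * b ^ (K - j) - ∑ j ∈ range (K + 1) with j + w K ≤ K, (-(E * b ^ (K - j))) := by
  rw [tiltedMean_dirac, tiltedMean_dirac, sum_neg_distrib]

/-- The Dirac ledger's one-run `QLa` (one slot per scale, influence `σ·E·b^{K−j}`, `σ = ±1`, `vol = 1`): each slice holds with equality. [folklore] -/
theorem dirac_ledger_qla {E b : ℝ} (hE : 0 ≤ E) (hb : 0 ≤ b) (K : ℕ) (σ : ℝ) (hσ : σ = 1 ∨ σ = -1) :
    QLa (range (K + 1)) id (fun j => σ * (E * b ^ (K - j))) (fun _ => 0) K 1 E b := by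
  intro j hj
  have hfil : (range (K + 1)).filter (fun X => id X = j) = {j} := by
    ext X; simp only [mem_filter, mem_range, id, mem_singleton]; constructor
    · rintro ⟨-, h⟩; exact h
    · intro h; subst h; exact ⟨Nat.lt_succ_of_le hj, rfl⟩
  rw [hfil, sum_singleton, sub_zero, abs_mul, one_mul]
  rcases hσ with h | h <;> simp [h, abs_of_nonneg (mul_nonneg hE (pow_nonneg hb _))]

/-- The old tail of the Dirac ledger dominates its `j⋆(K)`-term `E·b^{j⋆(K)}` (present iff `j⋆(K) ≤ K`). [folklore] -/
theorem le_dirac_ledger_tail {E b : ℝ} (hE : 0 ≤ E) (hb : 0 ≤ b) {w : ℕ → ℕ} {K : ℕ} (hwK : w K ≤ K) :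
    E * b ^ w K ≤ ∑ j ∈ range (K + 1) with j + w K ≤ K, E * b ^ (K - j) := by
  have hmem : K - w K ∈ (range (K + 1)).filter (fun j => j + w K ≤ K) :=
    mem_filter.mpr ⟨mem_range.mpr (by omega), by omega⟩
  have h := single_le_sum (f := fun j => E * b ^ (K - j)) (fun j _ => mul_nonneg hE (pow_nonneg hb _)) hmem
  simpa only [Nat.sub_sub_self hwK] using h

/-- ★ SHARPNESS: on the two-class Dirac ledger EVERY oscillation letter `ω` (any `ω` bounding the spread of the two classes' tilted means at some tilt) satisfies
`2·E·b^{w K} ≤ ω K` whenever `w K ≤ K`; hence for `E > 0`, `0 < b < 1` and a window bounded along a subsequence (`∃ᶠ K, w K ≤ M`), NO such `ω` is summable. -/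
theorem not_summable_osc_of_dirac_ledger_of_bounded_window {E b : ℝ} (hE : 0 < E) (hb0 : 0 < b) (hb1 : b ≤ 1) {w : ℕ → ℕ} {M : ℕ}
    (hM : ∃ᶠ K : ℕ in atTop, w K ≤ M) {ω : ℕ → ℝ}
    (hω : ∀ K : ℕ, |tiltedMean (fun x : ℝ => x) (Measure.dirac (∑ j ∈ range (K + 1) with j + w K ≤ K, E * b ^ (K - j))) 0
        - tiltedMean (fun x : ℝ => x) (Measure.dirac (-(∑ j ∈ range (K + 1) with j + w K ≤ K, E * b ^ (K - j)))) 0| ≤ ω K) :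
    ¬ Summable ω := by
  intro hs
  have hε : 0 < 2 * E * b ^ M := by positivity
  have hev : ∀ᶠ K : ℕ in atTop, ω K < 2 * E * b ^ M := hs.tendsto_atTop_zero.eventually (gt_mem_nhds hε)
  have hKM : ∀ᶠ K : ℕ in atTop, M ≤ K := eventually_ge_atTop M
  obtain ⟨K, hK, hlt, hMK⟩ := (hM.and_eventually (hev.and hKM)).exists
  have hwK : w K ≤ K := hK.trans hMK
  have hlow : 2 * E * b ^ w K ≤ ω K := by
    refine le_trans ?_ (hω K)
    rw [tiltedMean_dirac, tiltedMean_dirac, sub_neg_eq_add, ← two_mul,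
      abs_of_nonneg (by positivity : (0:ℝ) ≤ 2 * ∑ j ∈ range (K + 1) with j + w K ≤ K, E * b ^ (K - j))]
    have := le_dirac_ledger_tail hE.le hb0.le hwK
    linarith
  have hmono : b ^ M ≤ b ^ w K := pow_le_pow_of_le_one hb0.le hb1 hK
  nlinarith [hlow, hmono, hE]

end Sharpness


end YMDAG.N14.WindowOscillationLedger

end
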